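import Summits.ResolutionOfSingularities.KangarooAtlas.MizutaniAttainedForms
import Summits.ResolutionOfSingularities.KangarooAtlas.MizutaniInvFormsLevel
import Mathlib.Algebra.Field.ULift
import Mathlib.Algebra.Field.ZMod
import HarnessLib

/-!
# Mizutani's conjecture `m(e) = 2p^e − 1` — ATTAINMENT: `MizutaniAttained p e` holds for all `p`, `e`

Cell topic `Summits/ResolutionOfSingularities/KangarooAtlas` (pub-rosobs); namespace
`Summit.ResolutionOfSingularities.KangarooAtlas.Mizutani`.  Part of the Lean transcription of the
in-house note MIZUTANI-PROOF-g59 (AI-written, AI-audited; *AI review is weaker than expert review*; not a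
resolution theorem).  This file DISCHARGES the named fact `MizutaniAttained p e` of
`Literature/…/HironakaGroupScheme.lean` (Mizutani, Nagoya Math. J. 52 (1973), Remark 2.10: the schemes `H_e`
of exponent `e` and dimension `2p^e − 1`; Example 2.1), with Oda's printed description of the invariant
additive forms (`invForms`) as the definition, for the point `attP` of `ℙ^{2q−1}` over `k = 𝔽_p(u_0, u_1)`
(`MizutaniAttainedPoint`, `MizutaniAttainedForms`; in-house note §10).  WITNESS ATTRIBUTION, stated exactly:
`attP` (kernel of `X_i ↦ c_i T`, `c_i = u_0^{ε_i} u_1^{j_i}`, scalars through `F^e`; invariant form `a⁰`,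
`Σ_{j<q} u_1^{q−1−j}(u_0 x_{0j}^q − x_{1j}^q)`) is the LEVEL-`e` ANALOGUE OF MIZUTANI'S EXAMPLE 2.1 over a field
of `p`-rank `2`, for every `e` (for `e = 1` it IS Example 2.1 up to renaming the coordinates and signs); it is
not literally the `H_e` of Remark 2.10, which Mizutani sketches inductively ("H_2, H_3, …, H_e") from Example 2.1
using a FRESH `p`-basis element at each step (a field of `p`-rank `≥ e + 1`).  Both have exponent `e` and
dimension `2p^e − 1`, which is all `MizutaniAttained p e` asserts; the docstrings below saying «Mizutani's
`H_e`» mean «a scheme with the numerical characters of `H_e`».  Over an arbitrary field `k` with a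
`p`-independent pair `u` the same construction attains (`GenAtt.attP`, `mizutaniAttained_of_pIndep`), and some
point over `k` attains iff `[k : k^p] ≥ p²` (`mizutaniAttained_of_lt_rank`, `exponent_dichotomy`,
`MizutaniAttainedGeneral.lean`).

* `exponentLE_attP` — `exponent(B(attP)) ≤ e`: `(L_B)_{e+m} ⊇ k·F^m (L_B)_e` has dimension `≥ 1` while
  `dim (L_B)_{e+m} ≤ 1` (`finrank_invForms_attP_le_one`);
* `not_exponentLE_attP` — `exponent(B(attP)) ≰ e − 1`: otherwise `(L_B)_e = k·F (L_B)_{e−1}` would make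
  `a⁰` proportional to a vector of `p`-th powers, whence `u_1 = (b_{i₂}/b_{i₁})^p ∈ k^p` — absurd;
* `hsDimAt_attP` — `dim B(attP) + 1 = 2q`;
* **`mizutaniAttained`** — `MizutaniAttained p e` for every prime `p` and every `e` (universe-polymorphic via
  `ULift (ZMod p)`; `e = 0` by the vector group of a rational point).

References: [Mizutani1973HironakaGroupSchemes] Remark 2.10, Example 2.1; in-house note §10;
[Oda1983HironakaGroupSchemeII] §2 (p. 1168), Thm. 3.1 (iii).
-/

open MvPolynomial TensorProduct Literature.AlgebraicGeometry.Resolution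
  Literature.AlgebraicGeometry.Resolution.HironakaScheme

namespace Summit.ResolutionOfSingularities.KangarooAtlas.Mizutani

universe u

section Exponent

variable {F : Type u} [Field F] {p e : ℕ} [hp : Fact p.Prime] [CharP F p]

/-- `k · F^m (L_B)_e ⊆ (L_B)_{e+m}` (iterated `F`-stability). [cite: Oda1983HironakaGroupSchemeII, §2 (p. 1168: L_B is a k[F]-submodule)] -/
theorem span_frobVec_pow_le_invForms_attP : ∀ m : ℕ,
    Submodule.span (RatField F 2) (frobVec (RatField F 2) p m ''
      (invForms (RatField F 2) p (attP F p e) e : Set (Fin (attN p e + 1) → RatField F 2))) ≤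
      invForms (RatField F 2) p (attP F p e) (e + m)
  | 0 => by
    have : frobVec (RatField F 2) p 0 '' (invForms (RatField F 2) p (attP F p e) e : Set _) =
        (invForms (RatField F 2) p (attP F p e) e : Set (Fin (attN p e + 1) → RatField F 2)) := by
      have hid : frobVec (RatField F 2) p 0 = (id : (Fin (attN p e + 1) → RatField F 2) → _) :=
        funext (frobVec_zero (RatField F 2) p)
      rw [hid, Set.image_id]
    rw [this, Submodule.span_eq]
    exact le_rfl
  | m + 1 => by
    have hF1 : frobVec (RatField F 2) p (m + 1) =
        frobVec (RatField F 2) p 1 ∘ frobVec (RatField F 2) p m (n := attN p e) := by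
      funext v; rw [Function.comp_apply, frobVec_frobVec]
    rw [hF1, Set.image_comp, ← span_image_frobVec_span]
    refine le_trans (Submodule.span_mono (Set.image_mono (span_frobVec_pow_le_invForms_attP m))) ?_
    exact span_frobVec_image_le (RatField F 2) p (attP F p e) attP_ne_top (e + m)

/-- **`exponent(B(attP)) ≤ e`.** [cite: Mizutani1973HironakaGroupSchemes, Remark 2.10 (e(H_e) = e)] -/
theorem exponentLE_attP (hF : ∀ c : F, c ^ p = c) (he : 1 ≤ e) : ExponentLE (RatField F 2) p (attP F p e) e := by
  intro j hj
  obtain ⟨m, rfl⟩ := Nat.exists_eq_add_of_le hj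
  rw [Nat.add_sub_cancel_left]
  symm
  refine Submodule.eq_of_le_of_finrank_le (span_frobVec_pow_le_invForms_attP m) ?_
  rw [finrank_span_frobVec_image, finrank_invForms_attP hF he]
  exact finrank_invForms_attP_le_one hF he m

/-- The second distinguished index `i₂ = (1, q−2)` (needs `q ≥ 2`), where `a⁰_{i₂} = −u_1`. [folklore] -/
def attTop' (he : 1 ≤ e) : Fin (attN p e + 1) :=
  (attIdx p e).symm (1, ⟨p ^ e - 2, by
    have : 2 ≤ p ^ e := le_trans hp.out.two_le (by
      calc p = p ^ 1 := (pow_one p).symm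
        _ ≤ p ^ e := Nat.pow_le_pow_right hp.out.pos he)
    omega⟩)

/-- `a⁰_{i₂} = −u_1`. [folklore] -/
theorem attA0_attTop' (he : 1 ≤ e) : attA0 F p e (attTop' he) = -ratGen F 2 1 := by
  unfold attA0 attTop'
  rw [Equiv.apply_symm_apply]
  have : 2 ≤ p ^ e := le_trans hp.out.two_le (by
    calc p = p ^ 1 := (pow_one p).symm
      _ ≤ p ^ e := Nat.pow_le_pow_right hp.out.pos he)
  have hexp : p ^ e - 1 - (p ^ e - 2) = 1 := by omega
  simp [hexp]

/-- **`exponent(B(attP)) ≰ e − 1`**: if it were, `(L_B)_e = k · F (L_B)_{e−1}` would be spanned by a vector of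
`p`-th powers `(b_i^p)`, proportional to `a⁰`; comparing the coordinates `a⁰_{i*} = −1`, `a⁰_{i₂} = −u_1` gives
`u_1 = (b_{i₂}/b_{i*})^p ∈ k^p`, contradicting the `p`-independence of `u_1`.
[cite: Mizutani1973HironakaGroupSchemes, Remark 2.10 (e(H_e) = e exactly)] -/
theorem not_exponentLE_attP (hF : ∀ c : F, c ^ p = c) {e' : ℕ} (hee' : e = e' + 1) :
    ¬ ExponentLE (RatField F 2) p (attP F p e) e' := by
  have he : 1 ≤ e := by omega
  intro hE
  set K := RatField F 2 with hK
  -- `(L_B)_e = k · F (L_B)_{e'}` and both are one-dimensional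
  have heq : invForms K p (attP F p e) e =
      Submodule.span K (frobVec K p 1 '' (invForms K p (attP F p e) e' : Set (Fin (attN p e + 1) → K))) := by
    have := hE e (by omega)
    rwa [show e - e' = 1 by omega] at this
  have hdim' : Module.finrank K (invForms K p (attP F p e) e') = 1 := by
    rw [← finrank_span_frobVec_image K p 1, ← heq, finrank_invForms_attP hF he]
  obtain ⟨b, hb0, -⟩ := finrank_eq_one_iff'.mp hdim'
  -- `F b ∈ (L_B)_e ⊆ k · attV 0`, and `a⁰ ∈ k · attV 0`
  have hFb : frobVec K p 1 (b : Fin (attN p e + 1) → K) ∈ invForms K p (attP F p e) e := by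
    have := frobVec_one_mem_invForms K p (attP F p e) attP_ne_top b.2
    rwa [← hee'] at this
  have hle := invForms_attP_le_span (F := F) (p := p) (e := e) hF he 0
  obtain ⟨lam, hlam⟩ := Submodule.mem_span_singleton.mp (hle hFb)
  obtain ⟨mu, hmu⟩ := Submodule.mem_span_singleton.mp (hle (attA0_mem_invForms hF he))
  -- `F b ≠ 0`, `a⁰ ≠ 0`
  have hFb0 : frobVec K p 1 (b : Fin (attN p e + 1) → K) ≠ 0 := by
    intro h0
    apply hb0
    apply Subtype.ext
    funext i
    have := congrFun h0 i
    rw [frobVec_one_apply, Pi.zero_apply] at this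
    exact (pow_eq_zero_iff hp.out.ne_zero).mp this
  have hmu0 : mu ≠ 0 := by
    rintro rfl; rw [zero_smul] at hmu; exact attA0_ne_zero hmu.symm
  have hlam0 : lam ≠ 0 := by
    rintro rfl; rw [zero_smul] at hlam; exact hFb0 hlam.symm
  -- `F b = (lam/mu) • a⁰`
  have hprop : frobVec K p 1 (b : Fin (attN p e + 1) → K) = (lam * mu⁻¹) • attA0 F p e := by
    rw [← hlam, ← hmu, smul_smul, mul_assoc, inv_mul_cancel₀ hmu0, mul_one]
  -- read the two coordinates
  have h1 := congrFun hprop attTop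
  have h2 := congrFun hprop (attTop' he)
  rw [frobVec_one_apply, Pi.smul_apply, attA0_attTop, smul_eq_mul, mul_neg, mul_one] at h1
  rw [frobVec_one_apply, Pi.smul_apply, attA0_attTop' he, smul_eq_mul, mul_neg] at h2
  have hb1 : (b : Fin (attN p e + 1) → K) attTop ≠ 0 := by
    intro h0
    rw [h0, zero_pow hp.out.ne_zero] at h1
    exact (mul_ne_zero hlam0 (inv_ne_zero hmu0)) (neg_eq_zero.mp h1.symm)
  have hu1 : ratGen F 2 1 = ((b : Fin (attN p e + 1) → K) (attTop' he) / (b : Fin (attN p e + 1) → K) attTop) ^ p := by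
    rw [div_pow, h2, h1]
    field_simp
  exact ratGen_not_mem_frobPow (F := F) (s := 2) (p := p) 1
    (mem_frobPow_iff.mpr ⟨_, by rw [pow_one]; exact hu1.symm⟩)

/-- **`dim B(attP) + 1 = 2q`** (`dim B = (N+1) − dim_k (L_B)_e = 2q − 1`). [cite: Mizutani1973HironakaGroupSchemes, Remark 2.10 (dim H_e = 2p^e − 1)] -/
theorem hsDimAt_attP (hF : ∀ c : F, c ^ p = c) (he : 1 ≤ e) :
    hsDimAt (RatField F 2) p (attP F p e) e + 1 = 2 * p ^ e := by
  unfold hsDimAt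
  rw [finrank_invForms_attP hF he, attN_succ]
  have : 1 ≤ p ^ e := Nat.one_le_pow _ _ hp.out.pos
  omega

end Exponent

/-! ## Assembly -/

section Assembly

/-- Every element of `𝔽_p`, universe-lifted, is its own `p`-th power. [folklore] -/
theorem ulift_zmod_pow_char (p : ℕ) [Fact p.Prime] (c : ULift.{u} (ZMod p)) : c ^ p = c := by
  apply ULift.ext
  rw [ULift.pow_down]
  exact ZMod.pow_card c.down

/-- **Attainment for `e ≥ 1`**: the point `attP` over `𝔽_p(u_0, u_1)` (the level-`e` analogue of Mizutani's
Example 2.1; exponent `e` and dimension `2p^e − 1` like his `H_e`).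
[cite: Mizutani1973HironakaGroupSchemes, Remark 2.10 (H_e) and Example 2.1] -/
theorem mizutaniAttained_of_pos (p : ℕ) [Fact p.Prime] (e : ℕ) (he : 1 ≤ e) : MizutaniAttained.{u} p e := by
  obtain ⟨e', rfl⟩ : ∃ e', e = e' + 1 := ⟨e - 1, by omega⟩
  set F := ULift.{u} (ZMod p)
  have hF : ∀ c : F, c ^ p = c := ulift_zmod_pow_char p
  refine ⟨RatField F 2, inferInstance, inferInstance, attN p (e' + 1), attP F p (e' + 1), isPoint_attP,
    exponentLE_attP hF he, fun e'' he'' hE => ?_, hsDimAt_attP hF he⟩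
  exact not_exponentLE_attP hF rfl (hE.mono (by omega))

/-- **Attainment for `e = 0`**: the vector group `B(𝔭) ≅ 𝔾_a` of the rational point `𝔭 = 0 ⊂ k[X_0]` of `ℙ^0`
has exponent `0` and dimension `1 = 2p^0 − 1`. [cite: Mizutani1973HironakaGroupSchemes, Remark 1.2 (vector groups have exponent 0)] -/
theorem mizutaniAttained_zero (p : ℕ) [hp : Fact p.Prime] : MizutaniAttained.{u} p 0 := by
  set F := ULift.{u} (ZMod p)
  -- all invariant forms of `𝔭 = ⊥ ⊂ F[X_0]` vanish
  have hinv : ∀ j, invForms F p (⊥ : Ideal (MvPolynomial (Fin (0 + 1)) F)) j = ⊥ := by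
    intro j
    rw [eq_bot_iff]
    intro a ha
    have h := ha LinearMap.id (isDiffOpLE_id.of_le (Nat.zero_le _))
    rw [Ideal.mem_bot] at h
    unfold addForm at h
    rw [Fin.sum_univ_one] at h
    dsimp only [LinearMap.id_apply] at h
    rw [mul_eq_zero, C_eq_zero] at h
    rcases h with h | h
    · rw [Submodule.mem_bot]
      funext i
      rw [Fin.fin_one_eq_zero i, h]; rfl
    · exact absurd h (pow_ne_zero _ (X_ne_zero _))
  refine ⟨F, inferInstance, inferInstance, 0, ⊥, ⟨Ideal.isPrime_bot, ?_, ?_⟩, ?_, fun e' he' => absurd he' (Nat.not_lt_zero _), ?_⟩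
  · intro f hf d
    rw [Ideal.mem_bot] at hf
    rw [hf, map_zero]
    exact Ideal.zero_mem _
  · intro hle
    have hX : (X 0 : MvPolynomial (Fin (0 + 1)) F) ∈ irrelevant F 0 := by
      unfold irrelevant; rw [RingHom.mem_ker, constantCoeff_X]
    exact X_ne_zero _ (Ideal.mem_bot.mp (hle hX))
  · intro j _
    rw [hinv j, hinv 0, Nat.sub_zero]
    have : frobVec F p j '' ((⊥ : Submodule F (Fin (0 + 1) → F)) : Set (Fin (0 + 1) → F)) = {0} := by
      rw [Submodule.bot_coe, Set.image_singleton]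
      congr 1
      funext i
      show (0 : F) ^ p ^ j = 0
      exact zero_pow (pow_ne_zero j hp.out.ne_zero)
    rw [this, Submodule.span_zero_singleton]
  · unfold hsDimAt
    rw [hinv 0, finrank_bot]
    simp

/-- **ATTAINMENT `m(e) ≤ 2p^e − 1`: `MizutaniAttained p e` for every prime `p` and every `e`** — the named fact
of `Literature/…/HironakaGroupScheme.lean`, discharged by the level-`e` analogue of Example 2.1 over
`𝔽_p(u_0, u_1)` (a scheme with the exponent `e` and dimension `2p^e − 1` of Mizutani's `H_e`; `e = 0`: a rational
point).
[cite: Mizutani1973HironakaGroupSchemes, Remark 2.10 ("inductively we can construct examples H_2, H_3, …, H_e such that e(H_e) = e and dim H_e = 2p^e − 1") and Example 2.1] -/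
theorem mizutaniAttained (p : ℕ) [Fact p.Prime] (e : ℕ) : MizutaniAttained.{u} p e := by
  rcases Nat.eq_zero_or_pos e with rfl | he
  · exact mizutaniAttained_zero p
  · exact mizutaniAttained_of_pos p e he

end Assembly

end Summit.ResolutionOfSingularities.KangarooAtlas.Mizutani
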